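import Literature.MathematicalPhysics.QuantumFieldTheory.Balaban1983to89.B10Eq69Concrete
import Literature.MathematicalPhysics.QuantumFieldTheory.Balaban1983to89.B10Eq70Squaring
import Literature.MathematicalPhysics.QuantumFieldTheory.Balaban1983to89.B8Ineq130

/-!
# `Balaban1983to89.B10Eq69Local` — T. Bałaban, *Ultraviolet stability of three-dimensional lattice pure gauge
# field theories*, Commun. Math. Phys. **102** (1985) 255–275 [Balaban1985UV3]: (69) p. 273 with the PRINTED
# locality of (68) (*"on `B^j(Λ_j)`"*), and Sect. D's small factor (67)–(71) p. 273 for the concrete average of [4]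
# with (69) and the (11)-comparison DISCHARGED

statement-level skeleton of published theorems with citation tags; proofs where landed; nothing here is a claim
about the Yang–Mills mass gap

PDF held: `paper:balaban1985-cmp102-uv-stability-3d` (journal page = PDF page + 254); p. 273 (PDF 19) read from the
render `b2b-balaban-ref1/pages/1985-cmp102-uv-stability-3d/…-p019-x2.png` as an image.  "[4]" = [Balaban1985Averaging].

WHAT IS REPRODUCED (mega-formalization `lit-balaban`, Phase-2 proof seat `p29`; the knitting file after
`B7Eq50Linear`, `B10Eq69Concrete`, `B10Eq70Concrete`).  THE PRINTED TEXT (p. 273): *"Let us take a plaquette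
`p′ ⊂ Λ_j` and such that `|V_j(∂p′) − 1| ≥ g_jp(g_j)`. We have `Ū_k^j = V_j` on `Λ_j`, (67) and the configuration `U_k`
satisfies the following regularity condition on `B^j(Λ_j)`. `|U_k(∂p) − 1| < O(1)g_jp(g_j)L^{−2j}`. (68) Applying the
inequalities (50), (53) [4], we have `|Ū_k^j(∂p′) − 1| < Σ_{x∈B^j(x₀)} L^{−3j} Σ_{p⊂(p′)_x} |U_k(∂p) − 1| +
O(1)(g_jp(g_j))²`, (69) … Thus the part of the action `1/g_k² A^η(U_k)` localized to the sum of four `j`-blocks `Δ′`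
connected with the plaquette `p′` can be bounded from below by `¼p²(g_j)`, and the corresponding part of the
exponential gives the small factor `exp(−¼p²(g_j))`."*
* Row `B10.Eq69`, PRINTED LOCALITY (§1): `eq69_local_at`/`eq69_local` — the conclusion of `B10Eq69Concrete.eq69_at`
  for the concrete `j`-fold average `Ū^j = avgIter L U j` under (68) assumed ONLY for the unit plaquettes inside
  `Δ′ = B^j(x₀) ∪ B^j(y₀) ∪ B^j(z₀) ∪ B^j(w₀)` (`B7Prop1Local.pdevOn` over the box `[L^jz, L^jz + (L^j − 1)𝟙 + L^je_μ +
  L^je_ν]` = `B7Prop1Local.loK/plaqHiK`), removing MODEL NOTE (M3) of `B10Eq69Concrete` ((68) on all of `ηℤ^d`).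
  Mechanism = [4] p. 26 after (54) (*"it is enough to assume (52) for `p ⊂ B^k(x) ∪ B^k(y) ∪ B^k(z) ∪ B^k(w)`"*): the
  clamped extension of `U|Δ′` (`B7Prop1Local.clampCfg`) satisfies (68) everywhere, and has the same `Ū^j(∂p′)`
  (`hol_plaqWord_avgIter_congr`) and the same sum (69) (`plaqIn_translate`, `transSum_congr`,
  `B8Ineq130.hol_plaqWord_congr`).
* BRIDGE (§2): `transSum_eq_blockSum` — the sum (69) of `B10Eq69Concrete` (`transSum`, weight `L^{−dj}`, `range`
  indices) IS `B10Eq70Squaring.blockSum (L^j) (L^jz) μ ν (dev U μ ν)` (weight `(n^d)⁻¹`, `Fin n` indices, `n = L^j`);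
  `ineq69_blockSum` — (69) in the strict shape of the hypothesis `h69` of `B10Eq70Squaring.smallFactor_of_largeField`
  (`b = 6C₀α₀² > (16/3)C₀α₀²`).
* Rows `B10.Eq70`/`B10.Eq71` FOR THE CONCRETE AVERAGE (§3; `d = 3`, `G = U(N) ⊂ M_N(ℂ)`, operator norm):
  `smallFactor_of_largeField_concrete` = `B10Eq70Squaring.smallFactor_of_largeField` ((69) ∧ (67) ∧ (68) ∧ large
  field ⇒ (70) ⇒ (71) ⇒ localized action `≥ ¼p²(g_j)`) with BOTH of its non-printed hypotheses DISCHARGED — (69) `h69`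
  (by `ineq69_blockSum`) and `hact` `|U(∂p) − 1|² ≤ 2·N(1 − Re tr U(∂p))` (by
  `B10Eq70Squaring.dev_sq_le_two_act_unitary`); what is left is printed: (67), the large-field condition
  `|V_j(∂p′) − 1| ≥ g_jp(g_j)`, (68) on `Δ′`, `g_k² = g_j²L^{k−j}` (`g_k = g(L^kε)^{1/2}`), and *"`g_j` sufficiently
  small"* made explicit; `exp_localized_le_concrete` = the factor `exp(−¼p²(g_j))`.
MODEL NOTES.  (M1), (M2), (M4), (M5) of `B10Eq69Concrete` apply: general `d` in §§1–2 (`d = 3` in §3); `Ū^j =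
avgIter L U j` on `ℤ^d` after the rescaling `ξ ↦ 1` (`hol_rescale_plaqWord`); `≤` where print has `<` in (69); all
`O(1)` explicit (`(16/3)C₀α₀²`, resp. `6C₀α₀²` in the strict form; `α₀ = C₁g_jp(g_j)` the constant of (68)).
(M6) NORM / ACTION DENSITY as in `B10Eq70Squaring` §6 and `B10Eq70Concrete` (M6): operator norm (19) of [4], `act(p) =
N(1 − Re tr U(∂p))`, `tr = N⁻¹Tr` (cell DIVERGENCE D-b10.1: the factor `N` is absent only for the normalized
Hilbert–Schmidt norm, `B10Eq11Trace`).  (M7) `SU(N)`-valued configurations are covered through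
`B7Prop2SpecialUnitary.specialUnitaryUnits_le_unitaryUnits`.
Unit `lit-balaban-p29` (Phase-2 proof seat p29, gen 4); HOME `run/shared/lean/pub/lit-balaban/`.
-/

noncomputable section

open scoped BigOperators
open NormedSpace Finset

namespace Literature.MathematicalPhysics.QuantumFieldTheory.Balaban1983to89.B10Eq69Local

open B7Prop1Explicit B7Prop2Explicit B7Prop2SpecialUnitary B7Prop1Local B7Eq50Linear B10Eq69Concrete MatrixLog

export B7Prop1Explicit (Site) -- the `ℤ^d` sites (the torus `Site` of `Setup.lean` would shadow them)

variable {d : ℕ}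

/-- The Prop.-2 smallness `2α₀ ≤ c₂′(d, L) = (512(d+1)(d+4)L²)⁻¹` puts the Lemma-1 radius `32(d+1)(d+4)L²α₀`
below `¼` (the closure radius of `AvgClosed`). [folklore] -/
private theorem radius_le_quarter {L : ℕ} (hL : 2 ≤ L) {α₀ : ℝ} (hα2 : 2 * α₀ ≤ c2' d L) :
    32 * ((d : ℝ) + 1) * (d + 4) * (L : ℝ) ^ 2 * α₀ ≤ 1 / 4 := by
  have hL1 : (1 : ℝ) ≤ L := by exact_mod_cast le_trans (by norm_num) hL
  have hpos : (0 : ℝ) < 512 * ((d : ℝ) + 1) * (d + 4) * (L : ℝ) ^ 2 := by positivity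
  have h1 : 2 * α₀ ≤ 1 / (512 * ((d : ℝ) + 1) * (d + 4) * (L : ℝ) ^ 2) := hα2
  rw [le_div_iff₀ hpos] at h1
  linarith

/-! ## §1 Locality: the sum (69) and `Ū^j(∂p′)` see only the bonds of `Δ′` -/

section Local

variable {𝔸 : Type*} [NormedRing 𝔸]

/-- The fine plaquettes `p ⊂ (p′)_x`, `x ∈ B^j(x₀)`, of (69) all lie in `Δ′ = B^j(x₀) ∪ B^j(y₀) ∪ B^j(z₀) ∪ B^j(w₀)`
(the box `[L^j z, L^j z + (L^j − 1)𝟙 + L^j e_μ + L^j e_ν]` of `B7Prop1Local.plaqHiK`), for `μ ≠ ν`.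
[cite: Balaban1985UV3, (69)–(70) p.273] -/
theorem plaqIn_translate (L j : ℕ) (z : Site d) {μ ν : Fin d} (hμν : μ ≠ ν) (r : Fin d → Fin (L ^ j))
    {a b : ℕ} (ha : a < L ^ j) (hb : b < L ^ j) :
    PlaqIn (loK L j z) (plaqHiK L j z μ ν)
      (((L ^ j : ℕ) : ℤ) • z + boxVec (L ^ j) r + (a : ℤ) • e μ + (b : ℤ) • e ν, μ, ν) := by
  have ha' : (a : ℤ) + 1 ≤ (L : ℤ) ^ j := by exact_mod_cast ha
  have hb' : (b : ℤ) + 1 ≤ (L : ℤ) ^ j := by exact_mod_cast hb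
  have ha0 : (0 : ℤ) ≤ a := by positivity
  have hb0 : (0 : ℤ) ≤ b := by positivity
  refine ⟨fun i => ?_, fun i => ?_⟩
  all_goals
    have hr : (((r i : ℕ) : ℤ)) + 1 ≤ (L : ℤ) ^ j := by exact_mod_cast (r i).isLt
    have hr0 : (0 : ℤ) ≤ ((r i : ℕ) : ℤ) := by positivity
    simp only [loK, plaqHiK, boxVec, Pi.add_apply, Pi.smul_apply, smul_eq_mul, e_apply, mul_ite, mul_one,
      mul_zero, Nat.cast_pow]
    by_cases hiμ : i = μ
    · subst hiμ
      simp only [if_true, true_or, if_neg hμν]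
      constructor <;> linarith
    · by_cases hiν : i = ν
      · subst hiν
        simp only [if_true, or_true, if_neg hiμ]
        constructor <;> linarith
      · simp only [hiμ, hiν, or_self, if_false]
        constructor <;> linarith

/-- **Locality of the sum (69):** configurations agreeing on the bonds of `Δ′` have the same
`Σ_{x∈B^j(x₀)} L^{−dj} Σ_{p⊂(p′)_x} |U(∂p) − 1|`. [cite: Balaban1985UV3, (69) p.273] -/
theorem transSum_congr (L : ℕ) {V V' : Site d → Fin d → 𝔸ˣ} (j : ℕ) (z : Site d) {μ ν : Fin d} (hμν : μ ≠ ν)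
    (h : AgreeOn (loK L j z) (plaqHiK L j z μ ν) V V') : transSum L V μ ν j z = transSum L V' μ ν j z := by
  unfold transSum transSumN fineSum
  refine Finset.sum_congr rfl fun r _ => ?_
  congr 1
  refine Finset.sum_congr rfl fun a ha => Finset.sum_congr rfl fun b hb => ?_
  rw [Finset.mem_range] at ha hb
  have hp := plaqIn_translate L j z hμν r ha hb
  rw [B8Ineq130.hol_plaqWord_congr h _ _ _ hp.1 hp.2]

variable [NormOneClass 𝔸] [NormedAlgebra ℂ 𝔸] [CompleteSpace 𝔸]

/-- **B10 (69) WITH THE PRINTED LOCALITY of (68)** — print p. 273: *"the configuration `U_k` satisfies the following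
regularity condition on `B^j(Λ_j)`. (68)"*, `p′ ⊂ Λ_j`, so the four `j`-blocks `Δ′` at the corners of `p′` lie in
`B^j(Λ_j)`; and [4] p. 26 after (54): *"it is enough to assume (52) for `p ⊂ B^k(x) ∪ B^k(y) ∪ B^k(z) ∪ B^k(w)`"*.
Hypothesis: (68) ONLY for the unit plaquettes inside `Δ′` (`B7Prop1Local.pdevOn` over the box `[L^j z,
L^j z + (L^j − 1)𝟙 + L^j e_μ + L^j e_ν]`), gauge group closed at radius `t`; conclusion as in
`B10Eq69Concrete.eq69_at`.  Proof: the clamped extension `π^*U` of `U|Δ′` (`B7Prop1Local.clampCfg`) satisfies (68)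
on all of `ηℤ^d`, `eq69_at` applies to it, and both `Ū^j(∂p′)` (`hol_plaqWord_avgIter_congr`) and the sum (69)
(`transSum_congr`) are the same for `U` and `π^*U`. [cite: Balaban1985UV3, (68)–(69) p.273] -/
theorem eq69_local_at (L : ℕ) (hL : 2 ≤ L) {G : Subgroup 𝔸ˣ} {t : ℝ} (hG : AvgClosedAt d t L G) (j : ℕ)
    (U : Site d → Fin d → 𝔸ˣ) (hU : ∀ x κ, U x κ ∈ G) {α₀ : ℝ} (hα : 0 < α₀)
    (hα3 : C0 d * α₀ ≤ 1 / 3) (hα2 : 2 * α₀ ≤ c2' d L)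
    (hαt : 32 * ((d : ℝ) + 1) * (d + 4) * (L : ℝ) ^ 2 * α₀ ≤ t) (z : Site d) {μ ν : Fin d} (hμν : μ ≠ ν)
    (h68 : pdevOn (loK L j z) (plaqHiK L j z μ ν) U < α₀ * (((L : ℝ) ^ j)⁻¹) ^ 2) :
    ‖((hol (avgIter L U j) z (plaqWord μ ν) : 𝔸ˣ) : 𝔸) - 1‖
      ≤ transSum L U μ ν j z + 16 / 3 * C0 d * α₀ ^ 2 := by
  have hL1 : 1 ≤ L := le_trans (by norm_num) hL
  have hP : (1 : ℤ) ≤ (L : ℤ) ^ j := one_le_pow₀ (by exact_mod_cast hL1)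
  have hlohi : ∀ i, loK L j z i ≤ plaqHiK L j z μ ν i := fun i => by
    simp only [loK, plaqHiK]; split_ifs <;> linarith
  set V' := clampCfg (loK L j z) (plaqHiK L j z μ ν) U with hV'
  have hV'G : ∀ x κ, V' x κ ∈ G := clampCfg_mem hU
  have hUU : ∀ x κ, U x κ ∈ U1 𝔸 := fun x κ => hG.le_U1 (hU x κ)
  have h68' : pdev V' < α₀ * (((L : ℝ) ^ j)⁻¹) ^ 2 := (pdev_clampCfg_le hlohi hUU).trans_lt h68
  have h := eq69_at L hL hG j V' hV'G hα hα3 hα2 hαt h68' z hμν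
  rw [hol_plaqWord_avgIter_congr L hL1 j z μ ν (clampCfg_agree U).symm,
    transSum_congr L j z hμν (clampCfg_agree U).symm]
  exact h

/-- `eq69_local_at` for a gauge group closed at the absolute radius `1/4` (`AvgClosed`: the unitary group of a
C⋆-algebra, `U(N)`). [cite: Balaban1985UV3, (68)–(69) p.273] -/
theorem eq69_local (L : ℕ) (hL : 2 ≤ L) {G : Subgroup 𝔸ˣ} (hG : AvgClosed d L G) (j : ℕ)
    (U : Site d → Fin d → 𝔸ˣ) (hU : ∀ x κ, U x κ ∈ G) {α₀ : ℝ} (hα : 0 < α₀)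
    (hα3 : C0 d * α₀ ≤ 1 / 3) (hα2 : 2 * α₀ ≤ c2' d L) (z : Site d) {μ ν : Fin d} (hμν : μ ≠ ν)
    (h68 : pdevOn (loK L j z) (plaqHiK L j z μ ν) U < α₀ * (((L : ℝ) ^ j)⁻¹) ^ 2) :
    ‖((hol (avgIter L U j) z (plaqWord μ ν) : 𝔸ˣ) : 𝔸) - 1‖
      ≤ transSum L U μ ν j z + 16 / 3 * C0 d * α₀ ^ 2 := by
  exact eq69_local_at L hL (avgClosedAt_of_avgClosed hG le_rfl) j U hU hα hα3 hα2 (radius_le_quarter hL hα2) z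
    hμν h68

end Local

/-! ## §2 The sum (69) is the `blockSum` of `B10Eq70Squaring`: (69) discharges the hypothesis `h69` there -/

section Bridge

variable {𝔸 : Type*} [NormedRing 𝔸]

/-- The two spellings of the printed double sum of (69) agree: `transSum L U μ ν j z` (`B10Eq69Concrete`, weight
`L^{−dj}`, ranges) `=` `blockSum (L^j) (L^j z) μ ν (dev U μ ν)` (`B10Eq70Squaring`, weight `(n^d)⁻¹`, `Fin n`).
[cite: Balaban1985UV3, (69) p.273] -/
theorem transSum_eq_blockSum (L j : ℕ) (U : Site d → Fin d → 𝔸ˣ) (μ ν : Fin d) (z : Site d) :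
    transSum L U μ ν j z =
      B10Eq70Squaring.blockSum (L ^ j) ((L ^ j : ℕ) • z) μ ν (B10Eq70Squaring.dev U μ ν) := by
  set n : ℕ := L ^ j with hn
  have hnr : (n : ℝ) = (L : ℝ) ^ j := by rw [hn, Nat.cast_pow]
  have hz : (n • z : Site d) = (n : ℤ) • z := by
    funext κ; simp [Pi.smul_apply]
  rw [B10Eq70Squaring.blockSum_eq, hz]
  unfold transSum transSumN fineSum B10Eq70Squaring.corner B10Eq70Squaring.dev
  rw [← hn]
  refine Finset.sum_congr rfl fun r _ => ?_
  have hw : ((L : ℝ) ^ (d * j))⁻¹ = ((n : ℝ) ^ d)⁻¹ := by rw [hnr, ← pow_mul, mul_comm]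
  rw [hw]
  congr 1
  rw [Finset.sum_range (fun a => ∑ b ∈ Finset.range n,
    ‖((hol U ((n : ℤ) • z + boxVec n r + (a : ℤ) • e μ + (b : ℤ) • e ν) (plaqWord μ ν) : 𝔸ˣ) : 𝔸) - 1‖)]
  refine Finset.sum_congr rfl fun a _ => ?_
  rw [Finset.sum_range (fun b =>
    ‖((hol U ((n : ℤ) • z + boxVec n r + ((a : ℕ) : ℤ) • e μ + (b : ℤ) • e ν) (plaqWord μ ν) : 𝔸ˣ) : 𝔸) - 1‖)]

variable [NormOneClass 𝔸] [NormedAlgebra ℂ 𝔸] [CompleteSpace 𝔸]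

/-- **(69) ⇒ the hypothesis `h69` of `B10Eq70Squaring.smallFactor_of_largeField`** (strict, with `b = 6C₀α₀²`):
under the local (68) of `eq69_local_at`, `|Ū^j(∂p′) − 1| < blockSum + 6C₀α₀²`. [cite: Balaban1985UV3, (69) p.273] -/
theorem ineq69_blockSum (L : ℕ) (hL : 2 ≤ L) {G : Subgroup 𝔸ˣ} {t : ℝ} (hG : AvgClosedAt d t L G) (j : ℕ)
    (U : Site d → Fin d → 𝔸ˣ) (hU : ∀ x κ, U x κ ∈ G) {α₀ : ℝ} (hα : 0 < α₀)
    (hα3 : C0 d * α₀ ≤ 1 / 3) (hα2 : 2 * α₀ ≤ c2' d L)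
    (hαt : 32 * ((d : ℝ) + 1) * (d + 4) * (L : ℝ) ^ 2 * α₀ ≤ t) (z : Site d) {μ ν : Fin d} (hμν : μ ≠ ν)
    (h68 : pdevOn (loK L j z) (plaqHiK L j z μ ν) U < α₀ * (((L : ℝ) ^ j)⁻¹) ^ 2) :
    ‖((hol (avgIter L U j) z (plaqWord μ ν) : 𝔸ˣ) : 𝔸) - 1‖ <
      B10Eq70Squaring.blockSum (L ^ j) ((L ^ j : ℕ) • z) μ ν (B10Eq70Squaring.dev U μ ν) + 6 * C0 d * α₀ ^ 2 := by
  have h := eq69_local_at L hL hG j U hU hα hα3 hα2 hαt z hμν h68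
  rw [transSum_eq_blockSum] at h
  have hC : 0 < C0 d * α₀ ^ 2 := mul_pos (C0_pos d) (by positivity)
  linarith

end Bridge

/-! ## §3 Sect. D's small factor for ONE large-field plaquette, `d = 3`, `G = U(N)`: (67) ∧ (68) ⇒ (71),
with (69) and (70) DISCHARGED -/

section SmallFactor

open scoped Matrix.Norms.L2Operator
open B10Eq70Squaring

variable {N : ℕ} [NeZero N]

/-- **(67)–(71) p. 273 for the concrete average, `d = 3`, `G = U(N) ⊂ M_N(ℂ)` (operator norm), with (69) and (70)
proved rather than assumed:** `B10Eq70Squaring.smallFactor_of_largeField` (whose printed hypotheses (69) `h69` and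
the (11)-comparison `hact` are here DISCHARGED by `ineq69_blockSum` and `B10Eq70Squaring.dev_sq_le_two_act_unitary`)
— hypotheses left, all printed: (67) `Ū^j(∂p′) = V_j(∂p′)`, the large-field condition `|V_j(∂p′) − 1| ≥ g_jp(g_j)`,
(68) `|U_k(∂p) − 1| < C₁g_jp(g_j)L^{−2j}` for the unit plaquettes `p ⊂ Δ′` (all orientations), `g_k² = g_j²L^{k−j}`,
and "`g_j` sufficiently small": `0 < g_jp ≤ 1`, the Prop.-2 smallness of [4] for `α₀ = C₁g_jp` (`C₀α₀ ≤ ⅓`,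
`2α₀ ≤ c₂′(3, L)`) and `½(2C₁C₂ + C₂²)g_jp ≤ ¼` with `C₂ = 6C₀C₁²` (the `O(1)` of (69)).  Conclusion: the part of
`(1/g_k²)A^η(U_k)` localized in `Δ′`, with `act(p) = N(1 − Re tr U(∂p))` (operator-norm reading of (11), cell
DIVERGENCE D-b10.1), is `≥ ¼p²(g_j)`. [cite: Balaban1985UV3, (67)–(71) p.273] -/
theorem smallFactor_of_largeField_concrete (L : ℕ) (hL : 2 ≤ L) (j k : ℕ) (hjk : j ≤ k)
    (U Vj : Site 3 → Fin 3 → (Matrix (Fin N) (Fin N) ℂ)ˣ)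
    (hU : ∀ x κ, U x κ ∈ unitaryUnits (Matrix (Fin N) (Fin N) ℂ)) (z₀ : Site 3) {μ ν : Fin 3} (hμν : μ ≠ ν)
    {gj gk p C₁ : ℝ} (hgj : 0 < gj) (hgk : gk ^ 2 = gj ^ 2 * (L : ℝ) ^ (k - j)) (hp : 0 < p) (hC₁ : 0 < C₁)
    (hgp : gj * p ≤ 1)
    (h67 : hol (avgIter L U j) z₀ (plaqWord μ ν) = hol Vj z₀ (plaqWord μ ν))
    (hLF : gj * p ≤ ‖((hol Vj z₀ (plaqWord μ ν) : (Matrix (Fin N) (Fin N) ℂ)ˣ) : Matrix (Fin N) (Fin N) ℂ) - 1‖)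
    (h68 : pdevOn (loK L j z₀) (plaqHiK L j z₀ μ ν) U < C₁ * (gj * p) * (((L : ℝ) ^ j)⁻¹) ^ 2)
    (hα3 : C0 3 * (C₁ * (gj * p)) ≤ 1 / 3) (hα2 : 2 * (C₁ * (gj * p)) ≤ c2' 3 L)
    (hsmall : (2 * C₁ * (6 * C0 3 * C₁ ^ 2) + (6 * C0 3 * C₁ ^ 2) ^ 2) / 2 * gj * p ≤ 1 / 4) :
    p ^ 2 / 4 ≤ (gk ^ 2)⁻¹ * ((L : ℝ) ^ k * ∑ y ∈ deltaBox (L ^ j) ((L ^ j : ℕ) • z₀) μ ν,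
      (N : ℝ) * (1 - (N : ℝ)⁻¹ *
        (((hol U y (plaqWord μ ν) : (Matrix (Fin N) (Fin N) ℂ)ˣ) : Matrix (Fin N) (Fin N) ℂ).trace.re))) := by
  letI : CStarAlgebra (Matrix (Fin N) (Fin N) ℂ) := {}
  have hL1 : 1 ≤ L := le_trans (by norm_num) hL
  set α₀ : ℝ := C₁ * (gj * p) with hα₀
  have hα : 0 < α₀ := by positivity
  have hUU : ∀ x κ, U x κ ∈ U1 (Matrix (Fin N) (Fin N) ℂ) := fun x κ => unitaryUnits_le_U1 (hU x κ)
  -- (69), local, for `U(N)` (closed at radius 1/4)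
  have h69 := ineq69_blockSum L hL (avgClosedAt_of_avgClosed (avgClosed_unitaryUnits 3 L) le_rfl) j U hU hα
    hα3 hα2 (radius_le_quarter (d := 3) hL hα2) z₀ hμν h68
  -- (68) on the sub-plaquettes `p ⊂ (p′)_x` (they lie in `Δ′`)
  have hz : ((L ^ j : ℕ) • z₀ : Site 3) = ((L ^ j : ℕ) : ℤ) • z₀ := by
    funext κ; simp [Pi.smul_apply]
  have h68' : ∀ t : Idx 3 (L ^ j), dev U μ ν (corner (L ^ j) ((L ^ j : ℕ) • z₀) μ ν t) ≤
      C₁ * (gj * p) / ((L : ℝ) ^ j) ^ 2 := by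
    intro t
    have hmem := plaqIn_translate L j z₀ hμν t.1 t.2.1.isLt t.2.2.isLt
    have hle := le_pdevOn (lo := loK L j z₀) (hi := plaqHiK L j z₀ μ ν) hUU hmem
    have hα₀' : α₀ * (((L : ℝ) ^ j)⁻¹) ^ 2 = C₁ * (gj * p) / ((L : ℝ) ^ j) ^ 2 := by
      rw [hα₀, inv_pow, div_eq_mul_inv]
    unfold dev corner
    rw [hz, ← hα₀']
    exact hle.trans h68.le
  have hbB : 6 * C0 3 * α₀ ^ 2 ≤ (6 * C0 3 * C₁ ^ 2) * (gj * p) ^ 2 := le_of_eq (by rw [hα₀]; ring)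
  have hb : 0 ≤ 6 * C0 3 * α₀ ^ 2 := by have := (C0_pos 3).le; positivity
  exact smallFactor_of_largeField L hL1 j k hjk U Vj z₀ hμν _
    (fun y _ => dev_sq_le_two_act_unitary U hU μ ν y) hgj hgk hp.le hgp h67 hLF h68' h69 hb hbB hsmall

/-- **The small factor** (p. 273: *"the corresponding part of the exponential gives the small factor
`exp(−¼p²(g_j))`"*) for the concrete average, under the hypotheses of `smallFactor_of_largeField_concrete`:
`exp[−(1/g_k²)Σ_{p⊂Δ′}η⁻¹act(p)] ≤ exp(−¼p²(g_j))`. [cite: Balaban1985UV3, (71) p.273] -/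
theorem exp_localized_le_concrete (L : ℕ) (hL : 2 ≤ L) (j k : ℕ) (hjk : j ≤ k)
    (U Vj : Site 3 → Fin 3 → (Matrix (Fin N) (Fin N) ℂ)ˣ)
    (hU : ∀ x κ, U x κ ∈ unitaryUnits (Matrix (Fin N) (Fin N) ℂ)) (z₀ : Site 3) {μ ν : Fin 3} (hμν : μ ≠ ν)
    {gj gk p C₁ : ℝ} (hgj : 0 < gj) (hgk : gk ^ 2 = gj ^ 2 * (L : ℝ) ^ (k - j)) (hp : 0 < p) (hC₁ : 0 < C₁)
    (hgp : gj * p ≤ 1)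
    (h67 : hol (avgIter L U j) z₀ (plaqWord μ ν) = hol Vj z₀ (plaqWord μ ν))
    (hLF : gj * p ≤ ‖((hol Vj z₀ (plaqWord μ ν) : (Matrix (Fin N) (Fin N) ℂ)ˣ) : Matrix (Fin N) (Fin N) ℂ) - 1‖)
    (h68 : pdevOn (loK L j z₀) (plaqHiK L j z₀ μ ν) U < C₁ * (gj * p) * (((L : ℝ) ^ j)⁻¹) ^ 2)
    (hα3 : C0 3 * (C₁ * (gj * p)) ≤ 1 / 3) (hα2 : 2 * (C₁ * (gj * p)) ≤ c2' 3 L)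
    (hsmall : (2 * C₁ * (6 * C0 3 * C₁ ^ 2) + (6 * C0 3 * C₁ ^ 2) ^ 2) / 2 * gj * p ≤ 1 / 4) :
    Real.exp (-((gk ^ 2)⁻¹ * ((L : ℝ) ^ k * ∑ y ∈ deltaBox (L ^ j) ((L ^ j : ℕ) • z₀) μ ν,
      (N : ℝ) * (1 - (N : ℝ)⁻¹ *
        (((hol U y (plaqWord μ ν) : (Matrix (Fin N) (Fin N) ℂ)ˣ) : Matrix (Fin N) (Fin N) ℂ).trace.re))))) ≤
      Real.exp (-(p ^ 2 / 4)) := by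
  have h := smallFactor_of_largeField_concrete L hL j k hjk U Vj hU z₀ hμν hgj hgk hp hC₁ hgp h67 hLF h68 hα3 hα2
    hsmall
  exact Real.exp_le_exp.mpr (by linarith)

end SmallFactor

end Literature.MathematicalPhysics.QuantumFieldTheory.Balaban1983to89.B10Eq69Local
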